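import Summits.QuantumAdvantage.QuantumAdvantage.Theorems.LivenessSeparationLawP

set_option linter.dupNamespace false

/-!
# Liveness separation, part U — the exact designability criterion for ARBITRARY cut sets

Lens 4 (minimal counterexample), node `CoSupportDial`, memo S-PRIME §10.
Part Q proved, for 2-separated chains, that a residue pattern `R` is realised by an input iff `(★)` is
solvable.  For an arbitrary strictly increasing chain of cuts the criterion acquires one more, local,
condition: the filling the pattern asks for between cut `j` and cut `j + 1` must FIT into that gap
(`fit_necessary`: across a gap of length `d` the two residues differ by `d +` the number of ones inside, which
is at most `d`).  THE CRITERION (`residuePattern_fit_iff`, `livePattern_fit_iff`): `R` is realisable iff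
every filling fits and `(★)` is solvable.  Across gaps of length `≥ 2` the fit is automatic (part T,
`xPattern_fit_of_two_le`); across a gap of length `1` it says `R (j+1) ≠ R j` (part T, `xPattern_fit_adjacent_iff`):
adjacent cuts take any two DISTINCT residues and never equal ones.  (Checked by brute force for `n ≤ 8`
beforehand: lens data `adjcrit.py`, 496 989 instances.)
-/

namespace Summit.QuantumAdvantage.QuantumAdvantage.Theorems.LivenessSeparation

open Finset Summit.QuantumAdvantage.AdviceFreeQNC0 InnerDegreeDial

variable {n : ℕ}

section Criterion

variable {T : ℕ} {g : ℕ → ℕ}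

/-- **the fit condition is necessary:** if an input realises residues `R j`, `R (j+1)` at two consecutive cuts `g j < g (j+1) ≤ n`, the pattern
filling fits into the gap: the residues differ by the gap length plus the number of ones inside the gap. -/
theorem fit_necessary (c : ℕ) (u : Fin n → Bool) {R : ℕ → ℕ} (hR : ∀ j, R j ≤ 2) (xl : ℕ) {j : ℕ} (hj : j + 1 < T)
    (hlt : g j < g (j + 1)) (hgn1 : g (j + 1) ≤ n) (hRj : (c + g j + walkExp u (g j)) % 3 = R j % 3)
    (hRj1 : (c + g (j + 1) + walkExp u (g (j + 1))) % 3 = R (j + 1) % 3) :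
    g j + xPattern T g R xl j ≤ g (j + 1) := by
  have h1 := walkExp_eq_add_card u (le_of_lt hlt)
  have hw : (univ.filter fun i : Fin n => g j ≤ i.val ∧ i.val < g (j + 1) ∧ u i = true).card ≤ g (j + 1) - g j := by
    have hsub : (univ.filter fun i : Fin n => g j ≤ i.val ∧ i.val < g (j + 1) ∧ u i = true)
        ⊆ univ.filter fun i : Fin n => g j ≤ i.val ∧ i.val < g (j + 1) := by
      intro i
      simp only [mem_filter, mem_univ, true_and]
      exact fun h => ⟨h.1, h.2.1⟩
    have := card_le_card hsub
    rw [Summit.QuantumAdvantage.AdviceFreeQNC0.JLinPeel.SegMove.card_window hgn1] at this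
    exact this
  rw [xPattern_of_lt xl hj]
  have h4 := hR j
  have h5 := hR (j + 1)
  omega

/-- the fit condition does not depend on the final filling -/
theorem xPattern_fit_iff_zero {R : ℕ → ℕ} (xl : ℕ) {j : ℕ} (hj : j + 1 < T) :
    g j + xPattern T g R xl j ≤ g (j + 1) ↔ g j + xPattern T g R 0 j ≤ g (j + 1) := by
  rw [xPattern_of_lt xl hj, xPattern_of_lt 0 hj]

/-- **THE DESIGNABILITY CRITERION FOR ARBITRARY CUT SETS (residue form).**  On a strictly increasing chain `g 0 < ⋯ < g (T-1) ≤ n`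
a residue pattern `R ≤ 2` is realised by some input IFF every pattern filling fits into its gap AND `(★)` is solvable with `x₀ ≤ g 0`,
`xl ≤ 2`, `g (T-1) + xl ≤ n`. -/
theorem residuePattern_fit_iff (hmono : ∀ j, j + 1 < T → g j < g (j + 1)) (hT : 1 ≤ T) (hgn : g (T - 1) ≤ n) (c : ℕ)
    {R : ℕ → ℕ} (hR : ∀ j, R j ≤ 2) :
    (∃ u : Fin n → Bool, ∀ l < T, (c + g l + walkExp u (g l)) % 3 = R l % 3) ↔
      (∀ j, j + 1 < T → g j + xPattern T g R 0 j ≤ g (j + 1)) ∧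
        ∃ x₀ xl : ℕ, x₀ ≤ g 0 ∧ xl ≤ 2 ∧ g (T - 1) + xl ≤ n ∧
          (c + 2 * x₀ + xl + 2 * g 0 + 2 * g (T - 1) + R (T - 1) + 2 * (3 - R 0)) % 3 = 0 := by
  constructor
  · rintro ⟨u, hu⟩
    refine ⟨fun j hj => ?_, ?_⟩
    · exact fit_necessary c u hR 0 hj (hmono j hj)
        (le_trans (le_of_mono hmono (show j + 1 ≤ T - 1 by omega) (by omega)) hgn) (hu j (by omega)) (hu (j + 1) hj)
    · obtain ⟨x₀, xl, -, hx0, hxl, hxn, hst⟩ :=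
        pattern_necessary c u (le_of_mono hmono (Nat.zero_le _) (show T - 1 < T by omega)) hgn
      refine ⟨x₀, xl, hx0, hxl, hxn, ?_⟩
      have r0 := hu 0 (by omega)
      have rT := hu (T - 1) (by omega)
      have b0 := hR 0
      have bT := hR (T - 1)
      omega
  · rintro ⟨hfit, x₀, xl, hx0, -, hxn, hst⟩
    have hfit' : ∀ j, j + 1 < T → g j + xPattern T g R xl j ≤ g (j + 1) :=
      fun j hj => (xPattern_fit_iff_zero xl hj).2 (hfit j hj)
    exact ⟨_, fun l hl => walk_residue_gapPattern_fit hmono hfit' hT hgn hR hx0 hxn hst hl⟩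

/-- **THE DESIGNABILITY CRITERION FOR ARBITRARY CUT SETS (live-set form).**  A liveness pattern `L` on a strictly increasing chain is realised
by some input IFF some residue pattern `R ≤ 2` with `R l ≠ 0 ⟺ L l` has all fillings fitting and solves `(★)`. -/
theorem livePattern_fit_iff (hmono : ∀ j, j + 1 < T → g j < g (j + 1)) (hT : 1 ≤ T) (hgn : g (T - 1) ≤ n) (c : ℕ)
    (L : ℕ → Bool) :
    (∃ u : Fin n → Bool, ∀ l < T, ∀ gl : Fin (n + 1), gl.val = g l → liveCut c u gl = L l) ↔
      ∃ R : ℕ → ℕ, (∀ j, R j ≤ 2) ∧ (∀ l < T, (R l ≠ 0 ↔ L l = true)) ∧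
        (∀ j, j + 1 < T → g j + xPattern T g R 0 j ≤ g (j + 1)) ∧
          ∃ x₀ xl : ℕ, x₀ ≤ g 0 ∧ xl ≤ 2 ∧ g (T - 1) + xl ≤ n ∧
            (c + 2 * x₀ + xl + 2 * g 0 + 2 * g (T - 1) + R (T - 1) + 2 * (3 - R 0)) % 3 = 0 := by
  constructor
  · rintro ⟨u, hu⟩
    have hRu := (residuePattern_fit_iff hmono hT hgn c (R := fun l => (c + g l + walkExp u (g l)) % 3)
      (fun j => Nat.le_of_lt_succ (Nat.mod_lt _ (by omega)))).1 ⟨u, fun l _ => (Nat.mod_mod _ 3).symm⟩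
    refine ⟨fun l => (c + g l + walkExp u (g l)) % 3, fun j => Nat.le_of_lt_succ (Nat.mod_lt _ (by omega)),
      fun l hl => ?_, hRu.1, hRu.2⟩
    have hgl : g l ≤ n := le_trans (le_of_mono hmono (show l ≤ T - 1 by omega) (show T - 1 < T by omega)) hgn
    have h := hu l hl ⟨g l, by omega⟩ rfl
    simp only [liveCut] at h
    constructor
    · intro hne
      rw [← h]
      exact decide_eq_true hne
    · intro hL
      rw [hL] at h
      exact of_decide_eq_true h
  · rintro ⟨R, hR, hRL, hfit, x₀, xl, hx0, -, hxn, hst⟩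
    have hfit' : ∀ j, j + 1 < T → g j + xPattern T g R xl j ≤ g (j + 1) :=
      fun j hj => (xPattern_fit_iff_zero xl hj).2 (hfit j hj)
    obtain ⟨u, hu⟩ := livenessPattern_fit hmono hfit' hT hgn hR hx0 hxn hst
    refine ⟨u, fun l hl gl hgl => ?_⟩
    rw [hu l hl gl hgl]
    cases hLl : L l
    · exact decide_eq_false fun hne => by have := (hRL l hl).1 hne; rw [hLl] at this; exact Bool.false_ne_true this
    · exact decide_eq_true ((hRL l hl).2 hLl)

/-- **adjacent cuts are never co-dead, sharp form:** on any strictly increasing chain containing two ADJACENT cuts `g (j+1) = g j + 1`, no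
realisable residue pattern gives them equal residues — in particular no input makes both dead (cf. part R `adjacent_live_or_live`) —
while distinct residues are no local obstruction. -/
theorem adjacent_residues_ne (c : ℕ) (u : Fin n → Bool) {R : ℕ → ℕ} (hR : ∀ j, R j ≤ 2) {j : ℕ} (hj : j + 1 < T)
    (h1 : g (j + 1) = g j + 1) (hgn1 : g (j + 1) ≤ n) (hRj : (c + g j + walkExp u (g j)) % 3 = R j % 3)
    (hRj1 : (c + g (j + 1) + walkExp u (g (j + 1))) % 3 = R (j + 1) % 3) : R (j + 1) ≠ R j :=
  (xPattern_fit_adjacent_iff 0 hR hj h1).1 (fit_necessary c u hR 0 hj (by omega) hgn1 hRj hRj1)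

end Criterion

end Summit.QuantumAdvantage.QuantumAdvantage.Theorems.LivenessSeparation
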